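import Summits.PneNP.PneNP.Theorems.SfmBlSigningFP

/-!
# Line «sfm-bl»: `CandAvoidLinearFP` and `CandMatchAvoidLinearFP` from the cut-norm signing (stmt-PneNP-20226, stmt-PneNP-19962)

FRONTIER F-N1c/F-N1b — range avoidance for pure-`CAND` 3-local maps at linear stretch (`m ≥ 2^60·n`) by ONE
polynomial-time string function; nothing here bears on P vs NP.

The two landed reductions of `Nc03AvoidResidualCoreCandCutNormSigning` (p531401) applied to the closer
`SfmBlMachine.candCutNormSigningFP` (p564509): the cut-certified point printed by `sfmStr` lies outside the range.
-/

set_option linter.dupNamespace false -- `Summit.PneNP.PneNP.…`: summit = sub-problem name (D-0017 single-conjunct layout)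

namespace Summit.PneNP.PneNP.Theorems.SfmBlMachine

open Summit.PneNP.PneNP.Theorems.CandCutNorm

/-- **`CandAvoidLinearFP` (stmt-PneNP-20226): pure-`CAND` `NC⁰₃` range avoidance at linear stretch is in FP** —
the machine `sfmStr` with `C = 2^60`; its output is cut-certified, hence outside the range. -/
theorem candAvoidLinearFP : Summit.PneNP.PneNP.Theses.Nc03AvoidResidualCore.CandAvoidLinearFP :=
  candAvoidLinearFP_of_cutNormSigningFP candCutNormSigningFP

/-- **`CandMatchAvoidLinearFP` (stmt-PneNP-19962, the residual X₁ of rung F-N1b/F-N1c)**: the matching-class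
sub-family, by antitonicity. -/
theorem candMatchAvoidLinearFP : Summit.PneNP.PneNP.Theses.Nc03AvoidResidualCore.CandMatchAvoidLinearFP :=
  candMatchAvoidLinearFP_of_cutNormSigningFP candCutNormSigningFP

end Summit.PneNP.PneNP.Theorems.SfmBlMachine
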